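import Mathlib.LinearAlgebra.FreeModule.PID
import Mathlib.Algebra.Module.Torsion.Basic
import Mathlib.RingTheory.Finiteness.Basic
import Literature.AlgebraicTopology.SingularHomology.UniversalCoefficients
import Literature.AlgebraicTopology.SingularHomology.SingularChainsConcrete
import Literature.LinearAlgebra.FreeModule.SubmodulePID
import HarnessLib

/-!
# The universal coefficient theorem for cohomology: the Kronecker map is onto with torsion kernel
(discharge of `kroneckerMap_surjective` and `ker_kroneckerMap_le_torsion`, all degrees)

Sibling proof file of `Literature.AlgebraicTopology.SingularHomology.UniversalCoefficients`, which
vendors A. Hatcher, *Algebraic Topology* (2002), §3.1, Thm. 3.2 (p. 195; p. 197 over a principal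
ideal domain; pp. 198–199 for spaces) as the two named facts

* `kroneckerMap_surjective R X n`: the Kronecker map `h : Hⁿ(X; R) → Hom_R(Hₙ(X; R), R)` is onto;
* `ker_kroneckerMap_le_torsion R X n`: `ker (h : Hⁿ⁺¹ → Hom(Hₙ₊₁, R))` is torsion when `Hₙ(X; R)`
  is finitely generated (p. 196: "`Ext(H, ℤ)` is isomorphic to the torsion subgroup of `H` if `H`
  is finitely generated").

Both are PROVED here, for every space `X`, every degree `n` and every principal ideal domain `R`
(`kroneckerMap_surjective_holds`, `ker_kroneckerMap_le_torsion_holds`; the degree-one cases were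
proved earlier by a direct path argument in `KroneckerDegreeOne.lean`).  The proof is Hatcher's
(§3.1, pp. 191–195): the only input beyond homological algebra of the singular chain complex is
that **submodules of free modules over a PID are free in arbitrary rank** (Hungerford 1974,
Thm. IV.6.1, `Submodule.free_of_isPrincipalIdealRing` of
`Literature.LinearAlgebra.FreeModule.SubmodulePID`), applied to the boundaries
`Bₙ₋₁ = ∂Cₙ ⊆ Cₙ₋₁`:

* `exists_retraction_ker_of_free`: for `g : C → F` linear with `F` free, `ker g` is a retract of
  `C` (`im g` is free, hence projective, so `0 → ker g → C → im g → 0` splits) — Hatcher's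
  splitting of `0 → Zₙ → Cₙ → Bₙ₋₁ → 0`;
* `exists_extension_smul_of_finite_quotient`: for `B ≤ Z` with `Z ⧸ B` finitely generated, every
  functional `ψ` on `B` has a nonzero multiple `a • ψ` extending to `Z` — the torsion-ness of
  `Ext(Z ⧸ B, R) = coker (Hom(Z, R) → Hom(B, R))` (with `T` the torsion of `Z ⧸ B`, killed by
  some `a ≠ 0`, the quotient `(Z ⧸ B) ⧸ T` is finitely generated torsion-free, hence free, so
  `Z → (Z ⧸ B) ⧸ T` splits);
* chain level (`Cₙ(X; R)` is free on the singular simplices, via the comparison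
  `csingularChainComplex.compIsoX` with `SingularSimplex X n →₀ R`): the linear extension
  `evalChain φ : Cₙ(X; R) → R` of a cochain, `φ(∂c) = (δφ)(c)` (`evalChain_d`), and the
  **evaluation formula** `⟨[φ], [z]⟩ = φ(z)` (`kroneckerPairing_π_homologyπ`, from
  `kroneckerPairing_π_single` of `CapProduct.lean`);
* `kroneckerPairing_surjective`: given `f : Hₙ → R` and a retraction `p : Cₙ → Zₙ`, the cochain
  `φ(σ) = f [p σ]` is a cocycle with `h[φ] = f`;
* `finite_ker_quotient_range`: `Zₙ ⧸ Bₙ` (concretely, inside `Cₙ`) is a quotient of `Hₙ(X; R)`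
  (cokernel presentation `HomologicalComplex.homologyIsCokernel`), so it is finitely generated
  when `Hₙ(X; R)` is;
* `ker_kroneckerPairing_le_torsion`: if `⟨[φ], -⟩ = 0` then `φ = ψ ∘ ∂` on `Cₙ₊₁` for a functional
  `ψ` on `Bₙ`; extend `a • ψ` to `Zₙ` and then to `Cₙ` through `p`, obtaining an `n`-cochain `χ'`
  with `δχ' = a • φ`, whence `a • [φ] = 0`.

Nothing here is asserted; no statement of `UniversalCoefficients.lean` is modified.

## References

* A. Hatcher, *Algebraic Topology*, CUP 2002, §3.1: pp. 191–195 (the algebraic universal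
  coefficient theorem and the splitting of `0 → Zₙ → Cₙ → Bₙ₋₁ → 0`), Thm. 3.2 (p. 195), p. 196
  (`Ext(H, ℤ)` for `H` finitely generated), p. 197 (principal ideal domains), pp. 198–199
  (topological form). [Hatcher2002]
* T. W. Hungerford, *Algebra*, GTM 73, Springer 1974, Ch. IV Thm. 6.1. [Hungerford1974]
-/

noncomputable section

open CategoryTheory Limits Submodule

universe u v

namespace Literature.AlgebraicTopology.SingularHomology

/-! ### Two lemmas of linear algebra over a principal ideal domain -/

section Algebra

variable {R : Type*} [CommRing R] [IsDomain R] [IsPrincipalIdealRing R]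

/-- **The kernel of a linear map into a free module is a retract** (over a principal ideal
domain): for `g : C → F` with `F` free there is an idempotent-like endomorphism `p` of `C` with
values in `ker g` restricting to the identity on `ker g`.  This is the splitting of
`0 → Zₙ → Cₙ → Bₙ₋₁ → 0` in the proof of the universal coefficient theorem (Hatcher 2002, §3.1,
proof of Thm. 3.2: "`Bₙ₋₁` is free, being a subgroup of the free abelian group `Cₙ₋₁`"), with
Hungerford's Thm. IV.6.1 (`Submodule.free_of_isPrincipalIdealRing`) supplying freeness of
`im g ⊆ F` in arbitrary rank. [cite: Hatcher2002, §3.1 Thm. 3.2 (p. 195), proof] -/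
theorem exists_retraction_ker_of_free {C F : Type*} [AddCommGroup C] [Module R C]
    [AddCommGroup F] [Module R F] [Module.Free R F] (g : C →ₗ[R] F) :
    ∃ p : C →ₗ[R] C, (∀ x, g (p x) = 0) ∧ ∀ z, g z = 0 → p z = z := by
  haveI : Module.Projective R (LinearMap.range g) :=
    (LinearMap.range g).projective_of_isPrincipalIdealRing
  obtain ⟨s, hs⟩ := Module.projective_lifting_property g.rangeRestrict LinearMap.id
    (LinearMap.surjective_rangeRestrict g)
  refine ⟨LinearMap.id - s ∘ₗ g.rangeRestrict, fun x => ?_, fun z hz => ?_⟩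
  · have h1 : g.rangeRestrict (s (g.rangeRestrict x)) = g.rangeRestrict x :=
      LinearMap.congr_fun hs (g.rangeRestrict x)
    have h2 : g ((s (g.rangeRestrict x) : C)) = g x := by
      simpa [Subtype.ext_iff] using h1
    simp [h2]
  · have hz' : g.rangeRestrict z = 0 := Subtype.ext (by simpa using hz)
    simp [hz']

/-- **Extension of functionals up to a nonzero scalar.**  If `B ≤ Z` are modules over a
principal ideal domain with `Z ⧸ B` finitely generated, then for every linear map `ψ : B → N`
some nonzero multiple `a • ψ` (`a ≠ 0`) extends to `Z`.  This is the statement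
"`Ext(H, G)` is a torsion group when `H = Z ⧸ B` is finitely generated" of the universal
coefficient theorem (Hatcher 2002, §3.1, p. 196: "`Ext(H, ℤ)` is isomorphic to the torsion
subgroup of `H` if `H` is finitely generated"), in the form used below: with `T` the torsion of
`Z ⧸ B` (finitely generated, so killed by some `a ≠ 0`) the quotient `(Z ⧸ B) ⧸ T` is finitely
generated and torsion-free, hence free, so `Z → (Z ⧸ B) ⧸ T` has a section `s`; the retraction
`r = 1 - s π` maps `Z` into the preimage `Z'` of `T` and fixes `B`, and `z ↦ ψ (a • r z)` is the
required extension (`a • Z' ⊆ B`). [cite: Hatcher2002, §3.1 p. 196] -/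
theorem exists_extension_smul_of_finite_quotient {Z : Type*} [AddCommGroup Z] [Module R Z]
    (B : Submodule R Z) [Module.Finite R (Z ⧸ B)] {N : Type*} [AddCommGroup N] [Module R N]
    (ψ : B →ₗ[R] N) :
    ∃ a : R, a ≠ 0 ∧ ∃ χ : Z →ₗ[R] N, ∀ b : B, χ b = a • ψ b := by
  set T := torsion R (Z ⧸ B) with hT
  -- a nonzero annihilator of the (finitely generated) torsion of `Z ⧸ B`
  haveI : IsNoetherian R (Z ⧸ B) := isNoetherian_of_isNoetherianRing_of_finite R _
  haveI : Module.Finite R T := Module.IsNoetherian.finite R _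
  have hTt : Module.IsTorsion R T := fun ⟨x, hx⟩ => by
    obtain ⟨a, ha⟩ := (mem_torsion_iff x).mp hx
    exact ⟨a, Subtype.ext ha⟩
  obtain ⟨a, haT, ha0⟩ := Submodule.annihilator_top_inter_nonZeroDivisors hTt
  have ha : ∀ q : Z ⧸ B, q ∈ T → a • q = 0 := fun q hq => by
    have := (mem_annihilator.mp haT) ⟨q, hq⟩ mem_top
    exact congrArg Subtype.val this
  -- the torsion-free quotient is free, hence projective: split `Z → (Z ⧸ B) ⧸ T`
  set π₂ : Z →ₗ[R] (Z ⧸ B) ⧸ T := T.mkQ ∘ₗ B.mkQ with hπ₂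
  have hπ₂s : Function.Surjective π₂ :=
    (Submodule.mkQ_surjective T).comp (Submodule.mkQ_surjective B)
  haveI : Module.Free R ((Z ⧸ B) ⧸ T) := Module.free_of_finite_type_torsion_free'
  obtain ⟨s, hs⟩ := Module.projective_lifting_property π₂ LinearMap.id hπ₂s
  set r : Z →ₗ[R] Z := LinearMap.id - s ∘ₗ π₂ with hr
  have hrB : ∀ z, a • r z ∈ B := fun z => by
    have h1 : π₂ (r z) = 0 := by
      have := LinearMap.congr_fun hs (π₂ z)
      simp only [LinearMap.comp_apply, LinearMap.id_apply] at this
      simp [hr, this]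
    have h2 : B.mkQ (r z) ∈ T := by
      simpa [hπ₂, Submodule.Quotient.mk_eq_zero] using h1
    have h3 : B.mkQ (a • r z) = 0 := by rw [map_smul, ha _ h2]
    exact (Submodule.Quotient.mk_eq_zero B).mp h3
  have hrb : ∀ b : B, r b = b := fun b => by
    have hb0 : B.mkQ (b : Z) = 0 := (Submodule.Quotient.mk_eq_zero B).mpr b.2
    have : π₂ b = 0 := by simp [hπ₂, hb0]
    simp [hr, this]
  refine ⟨a, nonZeroDivisors.ne_zero ha0, ψ ∘ₗ LinearMap.codRestrict B (a • r) (fun z => hrB z),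
    fun b => ?_⟩
  have hb : LinearMap.codRestrict B (a • r) (fun z => hrB z) b = a • b := by
    apply Subtype.ext
    simp [hrb b]
  rw [LinearMap.comp_apply, hb, map_smul]

end Algebra

/-! ### Chain-level preliminaries: freeness, linear extension of cochains, evaluation -/

/-! **Linear extension of a cochain to chains.**  The functional `Cₙ(X; R) → R`,
`∑ rᵢ σᵢ ↦ ∑ rᵢ φ(σᵢ)`, attached to a cochain `φ : (singular n-simplices) → R` (Hatcher 2002,
§3.1: "`Cⁿ(X; G) = Hom(Cₙ(X), G)`") is written out in full as
`Finsupp.linearCombination R φ ∘ₗ (csingularChainComplex.compInv R R X n).hom` (coordinates in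
the concrete model `SingularSimplex X n →₀ R`, then the linear combination; informally
`evalChain φ` below); no definition is introduced, so that this file stays a pure proof file. -/

section Chains

variable (R : Type v) [CommRing R] {X : Type u} [TopologicalSpace X]

open singularChainComplex singularCochainComplex

/-- The modules of singular chains `Cₙ(X; R)` are free (Hatcher 2002, §2.1: `Cₙ(X) = ⊕_σ ℤ`; via
the comparison `csingularChainComplex.compIsoX` with the finitely supported functions
`SingularSimplex X n →₀ R`). [cite: Hatcher2002, §2.1] -/
theorem free_singularChainComplex_X (n : ℕ) : Module.Free R ((singularChainComplex R R X).X n) :=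
  Module.Free.of_equiv (csingularChainComplex.compIsoX R R X n).toLinearEquiv

variable {R}

/-- Every singular chain is the image of a concrete (finitely supported) chain under the
comparison map. [folklore] -/
lemma compHom_compInv_apply (n : ℕ) (c : (singularChainComplex R R X).X n) :
    (csingularChainComplex.compHom R R X n) ((csingularChainComplex.compInv R R X n) c) = c := by
  change (csingularChainComplex.compInv R R X n ≫ csingularChainComplex.compHom R R X n) c = c
  rw [csingularChainComplex.compInv_compHom]
  rfl

/-- Linear maps out of the module of singular chains agree if they agree on elementary chains
(`Cₙ(X; R)` is free on the singular simplices; Hatcher 2002, §2.1). [cite: Hatcher2002, §2.1] -/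
lemma linearMap_ext_single {n : ℕ} {N : Type*} [AddCommGroup N] [Module R N]
    {f g : (singularChainComplex R R X).X n →ₗ[R] N}
    (h : ∀ (σ : SingularSimplex X n) (r : R), f (single (R := R) σ r) = g (single (R := R) σ r)) :
    f = g := by
  have hc : f ∘ₗ (csingularChainComplex.compHom R R X n).hom =
      g ∘ₗ (csingularChainComplex.compHom R R X n).hom := by
    refine Finsupp.lhom_ext fun σ r => ?_
    rw [LinearMap.comp_apply, LinearMap.comp_apply, csingularChainComplex.compHom_single]
    exact h σ r
  refine LinearMap.ext fun c => ?_
  rw [← compHom_compInv_apply n c]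
  exact LinearMap.congr_fun hc _

/-- A singular chain is the finite sum of its elementary components:
`c = ∑_{σ ∈ supp w} (w σ) • σ` with `w = compInv c` its coordinate function. [folklore] -/
lemma eq_sum_single (n : ℕ) (c : (singularChainComplex R R X).X n) :
    c = ∑ σ ∈ ((csingularChainComplex.compInv R R X n) c).support,
      single (R := R) σ (((csingularChainComplex.compInv R R X n) c) σ) := by
  set w : CChain R X n := (csingularChainComplex.compInv R R X n) c with hw
  conv_lhs => rw [← compHom_compInv_apply n c, ← hw, ← Finsupp.sum_single w]
  rw [Finsupp.sum, map_sum]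
  refine Finset.sum_congr rfl fun σ _ => ?_
  exact csingularChainComplex.compHom_single σ (w σ)

/-- Evaluation on an elementary chain: `φ(r • σ) = r • φ(σ)`. [cite: Hatcher2002, §3.1] -/
@[simp]
lemma evalChain_single {n : ℕ} (φ : SingularSimplex X n → R) (σ : SingularSimplex X n) (r : R) :
    (Finsupp.linearCombination R (φ) ∘ₗ (csingularChainComplex.compInv R R X _).hom) (single (R := R) σ r) = r * φ σ := by
  change Finsupp.linearCombination R φ ((csingularChainComplex.compInv R R X n).hom _) = _
  rw [csingularChainComplex.compInv_single, Finsupp.linearCombination_single, smul_eq_mul]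

/-- **The coboundary is the transpose of the boundary**: `φ(∂c) = (δφ)(c)`
(Hatcher 2002, §3.1, "`δ = ∂*`"). [cite: Hatcher2002, §3.1] -/
lemma evalChain_d {n : ℕ} (φ : SingularSimplex X n → R) (c : (singularChainComplex R R X).X (n + 1)) :
    (Finsupp.linearCombination R (φ) ∘ₗ (csingularChainComplex.compInv R R X _).hom) ((singularChainComplex R R X).d (n + 1) n c) =
      (Finsupp.linearCombination R ((singularCochainComplex R R X).d n (n + 1) φ) ∘ₗ (csingularChainComplex.compInv R R X _).hom) c := by
  have key : (Finsupp.linearCombination R (φ) ∘ₗ (csingularChainComplex.compInv R R X _).hom) ∘ₗ ((singularChainComplex R R X).d (n + 1) n).hom =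
      (Finsupp.linearCombination R ((singularCochainComplex R R X).d n (n + 1) φ) ∘ₗ (csingularChainComplex.compInv R R X _).hom) := by
    refine linearMap_ext_single fun τ r => ?_
    rw [LinearMap.comp_apply, evalChain_single, singularCochainComplex.d_apply, Finset.mul_sum]
    change (Finsupp.linearCombination R (φ) ∘ₗ (csingularChainComplex.compInv R R X _).hom) ((singularChainComplex R R X).d (n + 1) n (single (R := R) τ r)) = _
    rw [singularChainComplex.d_single, map_sum]
    refine Finset.sum_congr rfl fun i _ => ?_
    rw [map_smul, evalChain_single, smul_eq_mul, smul_eq_mul]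
    ring
  exact LinearMap.congr_fun key c

/-- A cochain is recovered from its linear extension: `φ σ = φ(1 • σ)`. [folklore] -/
lemma evalChain_single_one {n : ℕ} (φ : SingularSimplex X n → R) (σ : SingularSimplex X n) :
    (Finsupp.linearCombination R (φ) ∘ₗ (csingularChainComplex.compInv R R X _).hom) (single (R := R) σ 1) = φ σ := by
  rw [evalChain_single, one_mul]

/-- The linear extension of the cochain `σ ↦ L(1 • σ)` read off from a functional `L` on chains
is `L` itself. [folklore] -/
lemma evalChain_apply_single_one {n : ℕ} (L : (singularChainComplex R R X).X n →ₗ[R] R) :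
    (Finsupp.linearCombination R (fun σ => L (single (R := R) σ 1)) ∘ₗ (csingularChainComplex.compInv R R X _).hom) = L :=
  linearMap_ext_single fun σ r => by
    rw [evalChain_single]
    have e : single (R := R) σ r = r • single (R := R) σ (1 : R) := by
      rw [← singularChainComplex.single_smul, smul_eq_mul, mul_one]
    rw [e, map_smul, smul_eq_mul]

/-- **Evaluation formula**: the Kronecker pairing of a cocycle class with a cycle class is the
value of the (linearly extended) cocycle on the cycle, `⟨[φ], [z]⟩ = φ(z)` (Hatcher 2002, §3.1,
p. 191). [cite: Hatcher2002, §3.1 p. 191] -/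
theorem kroneckerPairing_π_homologyπ {n : ℕ} (a : cocycles R R X n) (z : cycles R R X n) :
    kroneckerPairing R R X n (singularCohomology.π R R X n a)
      ((singularChainComplex R R X).homologyπ n z) =
        (Finsupp.linearCombination R (iCocycles R R X n a) ∘ₗ (csingularChainComplex.compInv R R X _).hom) (iCycles R R X n z) := by
  set w : CChain R X n := (csingularChainComplex.compInv R R X n) (iCycles R R X n z) with hw
  have hz := eq_sum_single n (iCycles R R X n z)
  rw [kroneckerPairing_π_single w.support (fun σ => σ) (fun σ => w σ) a z hz]
  conv_rhs => rw [hz, map_sum]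
  refine Finset.sum_congr rfl fun σ _ => ?_
  rw [evalChain_single, smul_eq_mul, mul_comm]

/-- Every chain with vanishing boundary is (the underlying chain of) a cycle. [folklore] -/
lemma exists_cycles_of_d_eq_zero {n j : ℕ} (hj : (ComplexShape.down ℕ).next n = j)
    (c : (singularChainComplex R R X).X n) (hc : (singularChainComplex R R X).d n j c = 0) :
    ∃ z : cycles R R X n, iCycles R R X n z = c :=
  ⟨(singularChainComplex R R X).cyclesMk c j hj hc, (singularChainComplex R R X).i_cyclesMk c j hj hc⟩

end Chains

/-! ### Surjectivity of the Kronecker map (Hatcher Thm. 3.2, all degrees) -/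

section Surjective

variable (R : Type v) [CommRing R] [IsDomain R] [IsPrincipalIdealRing R]
  (X : Type u) [TopologicalSpace X]

open singularChainComplex singularCochainComplex

/-- **The Kronecker map `h : Hⁿ(X; R) → Hom_R(Hₙ(X; R), R)` is surjective**, for every space
`X`, every `n` and every principal ideal domain `R` (Hatcher 2002, §3.1, Thm. 3.2, p. 195, with
pp. 197–199).  Proof as printed (p. 191 ff.): `Bₙ₋₁ ⊆ Cₙ₋₁` is free (Hungerford IV.6.1), so
`0 → Zₙ → Cₙ → Bₙ₋₁ → 0` splits and there is a retraction `p : Cₙ → Zₙ`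
(`exists_retraction_ker_of_free`); given `f : Hₙ → R`, the cochain `φ(σ) = f [p σ]` is a cocycle
(`δφ(τ) = f [p ∂τ] = f [∂τ] = 0`) with `⟨[φ], [z]⟩ = f [p z] = f [z]`. PROVED.
[cite: Hatcher2002, §3.1 Thm. 3.2 (p. 195)] -/
theorem kroneckerPairing_surjective (n : ℕ) : Function.Surjective (kroneckerPairing R R X n) := by
  intro f
  set K := singularChainComplex R R X with hK
  set j := (ComplexShape.down ℕ).next n with hj
  -- the retraction `p : Cₙ → Zₙ = ker (∂ : Cₙ → C_j)`
  haveI : Module.Free R (K.X j) := free_singularChainComplex_X R j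
  obtain ⟨p, hp₁, hp₂⟩ := exists_retraction_ker_of_free (R := R) (K.d n j).hom
  have hpd : ModuleCat.ofHom p ≫ K.d n j = 0 := by
    ext x
    exact hp₁ x
  let P : K.X n ⟶ cycles R R X n := K.liftCycles (ModuleCat.ofHom p) j rfl hpd
  have hPi : ∀ c, iCycles R R X n (P c) = p c := fun c => by
    change (P ≫ K.iCycles n) c = p c
    rw [K.liftCycles_i]
    rfl
  -- `P` fixes cycles and sends boundaries to boundaries
  have hPz : ∀ z : cycles R R X n, P (iCycles R R X n z) = z := fun z =>
    cycles_ext (by rw [hPi, hp₂ _ (d_iCycles j z)])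
  have hPd : ∀ w : K.X (n + 1), P (K.d (n + 1) n w) = toCycles R R X (n + 1) n w := fun w =>
    cycles_ext (by
      rw [hPi, iCycles_toCycles]
      refine hp₂ _ ?_
      change (K.d (n + 1) n ≫ K.d n j) w = 0
      rw [K.d_comp_d]
      rfl)
  -- the functional `L = f ∘ [·] ∘ P` and the cochain `φ(σ) = L(σ)`
  let L : K.X n →ₗ[R] R := f ∘ₗ (P ≫ K.homologyπ n).hom
  have hL : ∀ c, L c = f (K.homologyπ n (P c)) := fun c => rfl
  let φ : SingularSimplex X n → R := fun σ => L (single (R := R) σ 1)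
  have hφL : (Finsupp.linearCombination R (φ) ∘ₗ (csingularChainComplex.compInv R R X _).hom) = L := evalChain_apply_single_one L
  -- `φ` is a cocycle
  have hδ : (singularCochainComplex R R X).d n (n + 1) φ = 0 := by
    refine singularCochainComplex.ext fun τ => ?_
    rw [← evalChain_single_one ((singularCochainComplex R R X).d n (n + 1) φ) τ, ← evalChain_d,
      hφL, hL, hPd, homologyπ_toCycles, map_zero]
    rfl
  refine ⟨singularCohomology.π R R X n (cocyclesMk φ hδ), LinearMap.ext fun y => ?_⟩
  induction y using singularHomology_induction_on with
  | h z =>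
    rw [kroneckerPairing_π_homologyπ, iCocycles_mk, hφL, hL, hPz]

/-- **Discharge of the named fact `kroneckerMap_surjective R X n`** (Hatcher 2002, Thm. 3.2, as
vendored in `UniversalCoefficients.lean`), for every principal ideal domain `R`, space `X` and
degree `n`. [cite: Hatcher2002, §3.1 Thm. 3.2 (p. 195)] -/
theorem kroneckerMap_surjective_holds (n : ℕ) : kroneckerMap_surjective R X n :=
  kroneckerPairing_surjective R X n

end Surjective

/-! ### The kernel of the Kronecker map is torsion (Hatcher Thm. 3.2 and p. 196, all degrees) -/

section Torsion

variable (R : Type v) [CommRing R] [IsDomain R] [IsPrincipalIdealRing R]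
  (X : Type u) [TopologicalSpace X]

open singularChainComplex singularCochainComplex

omit [IsDomain R] [IsPrincipalIdealRing R] in
/-- **Finite generation of `Zₙ ⧸ Bₙ` from finite generation of `Hₙ(X; R)`**: the concrete
quotient of the cycles `Zₙ = ker (∂ : Cₙ → C_{next n})` by the boundaries coming from `Cₙ₊₁` is
a quotient of the homology module `Hₙ(X; R)` (the cokernel presentation
`HomologicalComplex.homologyIsCokernel` of `Hₙ = Zₙ/Bₙ`; Hatcher 2002, §2.1). [cite: Hatcher2002, §2.1] -/
lemma finite_ker_quotient_range (n : ℕ) [Module.Finite R (singularHomology R R X n)] :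
    Module.Finite R
      (LinearMap.ker ((singularChainComplex R R X).d n ((ComplexShape.down ℕ).next n)).hom ⧸
        LinearMap.range (((singularChainComplex R R X).d (n + 1) n).hom.codRestrict
          (LinearMap.ker ((singularChainComplex R R X).d n ((ComplexShape.down ℕ).next n)).hom)
          (fun c => LinearMap.mem_ker.mpr (by
            change ((singularChainComplex R R X).d (n + 1) n ≫
              (singularChainComplex R R X).d n ((ComplexShape.down ℕ).next n)) c = 0
            rw [HomologicalComplex.d_comp_d]
            rfl)))) := by
  set K := singularChainComplex R R X with hK
  set j := (ComplexShape.down ℕ).next n with hj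
  set Z : Submodule R (K.X n) := LinearMap.ker (K.d n j).hom with hZ
  have hdd : ∀ c : K.X (n + 1), (K.d (n + 1) n).hom c ∈ Z := fun c => LinearMap.mem_ker.mpr (by
    change (K.d (n + 1) n ≫ K.d n j) c = 0
    rw [K.d_comp_d]
    rfl)
  set dZ : K.X (n + 1) →ₗ[R] Z := (K.d (n + 1) n).hom.codRestrict Z hdd with hdZ
  set B : Submodule R Z := LinearMap.range dZ with hB
  change Module.Finite R (Z ⧸ B)
  -- the map `cycles → Z ⧸ B`, killing boundaries
  have hiZ : ∀ z : cycles R R X n, (K.iCycles n).hom z ∈ Z := fun z =>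
    LinearMap.mem_ker.mpr (d_iCycles j z)
  let g₀ : cycles R R X n ⟶ ModuleCat.of R (Z ⧸ B) :=
    ModuleCat.ofHom (B.mkQ ∘ₗ (K.iCycles n).hom.codRestrict Z hiZ)
  have hg₀ : ∀ z : cycles R R X n, g₀ z = B.mkQ ⟨iCycles R R X n z, hiZ z⟩ := fun z => rfl
  have hcond : K.toCycles (n + 1) n ≫ g₀ = 0 := by
    ext c
    change g₀ (toCycles R R X (n + 1) n c) = 0
    rw [hg₀, Submodule.mkQ_apply, Submodule.Quotient.mk_eq_zero]
    refine ⟨c, Subtype.ext ?_⟩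
    change (K.d (n + 1) n).hom c = iCycles R R X n (toCycles R R X (n + 1) n c)
    rw [iCycles_toCycles]
  let desc : K.homology n ⟶ ModuleCat.of R (Z ⧸ B) :=
    (K.homologyIsCokernel (n + 1) n (ChainComplex.prev ℕ n)).desc (CokernelCofork.ofπ g₀ hcond)
  have hdesc : K.homologyπ n ≫ desc = g₀ :=
    (K.homologyIsCokernel (n + 1) n (ChainComplex.prev ℕ n)).fac (CokernelCofork.ofπ g₀ hcond)
      WalkingParallelPair.one
  refine Module.Finite.of_surjective desc.hom fun q => ?_
  obtain ⟨⟨c, hc⟩, rfl⟩ := Submodule.mkQ_surjective B q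
  obtain ⟨z, hz⟩ := exists_cycles_of_d_eq_zero rfl c (LinearMap.mem_ker.mp hc)
  refine ⟨K.homologyπ n z, ?_⟩
  change (K.homologyπ n ≫ desc) z = _
  rw [hdesc, hg₀]
  exact congrArg B.mkQ (Subtype.ext hz)

/-- **The kernel of the Kronecker map `h : Hⁿ⁺¹(X; R) → Hom_R(Hₙ₊₁(X; R), R)` is torsion when
`Hₙ(X; R)` is finitely generated** (Hatcher 2002, §3.1, Thm. 3.2, p. 195: `ker h = Ext(Hₙ, R)`;
p. 196: "`Ext(H, ℤ)` is isomorphic to the torsion subgroup of `H` if `H` is finitely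
generated"; p. 197 over a PID), for every space `X`, degree `n` and PID `R`.  Proof: let `φ` be
an `(n+1)`-cocycle with `⟨[φ], -⟩ = 0`, i.e. `φ` vanishes on `Zₙ₊₁`; then `φ = ψ ∘ ∂` for a
functional `ψ` on `Bₙ = ∂Cₙ₊₁ ⊆ Zₙ`; since `Zₙ/Bₙ = Hₙ` is finitely generated, `a • ψ` extends
to `χ` on `Zₙ` for some `a ≠ 0` (`exists_extension_smul_of_finite_quotient`), and further to
`Cₙ` through the retraction `Cₙ → Zₙ` (`exists_retraction_ker_of_free`); the resulting
`n`-cochain `χ'` has `δχ' = a • φ`, so `a • [φ] = 0`. PROVED.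
[cite: Hatcher2002, §3.1 Thm. 3.2 (p. 195) and p. 196] -/
theorem ker_kroneckerPairing_le_torsion (n : ℕ) [Module.Finite R (singularHomology R R X n)] :
    LinearMap.ker (kroneckerPairing R R X (n + 1)) ≤
      Submodule.torsion R (singularCohomology R R X (n + 1)) := by
  intro x hx
  rw [LinearMap.mem_ker] at hx
  set K := singularChainComplex R R X with hK
  set j := (ComplexShape.down ℕ).next n with hj
  set Z : Submodule R (K.X n) := LinearMap.ker (K.d n j).hom with hZ
  have hdd : ∀ c : K.X (n + 1), (K.d (n + 1) n).hom c ∈ Z := fun c => LinearMap.mem_ker.mpr (by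
    change (K.d (n + 1) n ≫ K.d n j) c = 0
    rw [K.d_comp_d]
    rfl)
  set dZ : K.X (n + 1) →ₗ[R] Z := (K.d (n + 1) n).hom.codRestrict Z hdd with hdZ
  set B : Submodule R Z := LinearMap.range dZ with hB
  haveI : Module.Finite R (Z ⧸ B) := finite_ker_quotient_range R X n
  -- represent `x` by a cocycle `φ`
  induction x using singularCohomology_induction_on with
  | h φc =>
    set φ : SingularSimplex X (n + 1) → R := iCocycles R R X (n + 1) φc with hφ
    -- `φ` vanishes on `(n+1)`-cycles
    have hE : ∀ c : K.X (n + 1), (K.d (n + 1) n).hom c = 0 → (Finsupp.linearCombination R (φ) ∘ₗ (csingularChainComplex.compInv R R X _).hom) c = 0 := by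
      intro c hc
      obtain ⟨z, rfl⟩ := exists_cycles_of_d_eq_zero (ChainComplex.next_nat_succ n) c hc
      rw [hφ, ← kroneckerPairing_π_homologyπ, hx, LinearMap.zero_apply]
    -- `ψ : Bₙ → R` with `ψ (∂c) = φ(c)`
    have hker : LinearMap.ker dZ ≤ LinearMap.ker ((Finsupp.linearCombination R (φ) ∘ₗ (csingularChainComplex.compInv R R X _).hom)) := by
      intro c hc
      rw [LinearMap.mem_ker] at hc ⊢
      exact hE c (congrArg Subtype.val hc)
    let ψ : B →ₗ[R] R := (LinearMap.ker dZ).liftQ ((Finsupp.linearCombination R (φ) ∘ₗ (csingularChainComplex.compInv R R X _).hom)) hker ∘ₗ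
      dZ.quotKerEquivRange.symm.toLinearMap
    have hψ : ∀ c : K.X (n + 1), ψ ⟨dZ c, LinearMap.mem_range_self dZ c⟩ = (Finsupp.linearCombination R (φ) ∘ₗ (csingularChainComplex.compInv R R X _).hom) c := by
      intro c
      change (LinearMap.ker dZ).liftQ ((Finsupp.linearCombination R (φ) ∘ₗ (csingularChainComplex.compInv R R X _).hom)) hker (dZ.quotKerEquivRange.symm ⟨dZ c, _⟩) = _
      rw [LinearMap.quotKerEquivRange_symm_apply_image, Submodule.mkQ_apply, Submodule.liftQ_apply]
    -- extend `a • ψ` to `χ : Zₙ → R`, then to `Cₙ` through the retraction `p`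
    obtain ⟨a, ha0, χ, hχ⟩ := exists_extension_smul_of_finite_quotient B ψ
    haveI : Module.Free R (K.X j) := free_singularChainComplex_X R j
    obtain ⟨p, hp₁, hp₂⟩ := exists_retraction_ker_of_free (R := R) (K.d n j).hom
    let p' : K.X n →ₗ[R] Z := p.codRestrict Z fun c => LinearMap.mem_ker.mpr (hp₁ c)
    let L : K.X n →ₗ[R] R := χ ∘ₗ p'
    let χ' : SingularSimplex X n → R := fun σ => L (single (R := R) σ 1)
    have hχ'L : (Finsupp.linearCombination R (χ') ∘ₗ (csingularChainComplex.compInv R R X _).hom) = L := evalChain_apply_single_one L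
    have hLd : ∀ c : K.X (n + 1), L ((K.d (n + 1) n).hom c) = a * (Finsupp.linearCombination R (φ) ∘ₗ (csingularChainComplex.compInv R R X _).hom) c := by
      intro c
      have hpc : p' ((K.d (n + 1) n).hom c) = dZ c :=
        Subtype.ext (hp₂ _ (LinearMap.mem_ker.mp (hdd c)))
      change χ (p' ((K.d (n + 1) n).hom c)) = _
      rw [hpc, show dZ c = ((⟨dZ c, LinearMap.mem_range_self dZ c⟩ : B) : Z) from rfl, hχ, hψ,
        smul_eq_mul]
    -- `δχ' = a • φ`
    have hδ : (singularCochainComplex R R X).d n (n + 1) χ' = a • φ := by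
      refine singularCochainComplex.ext fun τ => ?_
      rw [← evalChain_single_one ((singularCochainComplex R R X).d n (n + 1) χ') τ, ← evalChain_d,
        hχ'L]
      change L ((K.d (n + 1) n).hom (single (R := R) τ 1)) = _
      rw [hLd, evalChain_single_one]
      rfl
    -- hence `a • [φ] = [δχ'] = 0`
    refine (Submodule.mem_torsion_iff _).mpr ⟨⟨a, mem_nonZeroDivisors_of_ne_zero ha0⟩, ?_⟩
    change a • singularCohomology.π R R X (n + 1) φc = 0
    have hcyc : a • φc = toCocycles R R X n (n + 1) χ' := by
      apply (ModuleCat.mono_iff_injective (iCocycles R R X (n + 1))).1 inferInstance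
      rw [map_smul]
      change a • φ = (toCocycles R R X n (n + 1) ≫ iCocycles R R X (n + 1)) χ'
      rw [HomologicalComplex.toCycles_i, hδ]
    rw [← map_smul, hcyc]
    change (toCocycles R R X n (n + 1) ≫ (singularCochainComplex R R X).homologyπ (n + 1)) χ' = 0
    rw [HomologicalComplex.toCycles_comp_homologyπ]
    rfl

/-- **Discharge of the named fact `ker_kroneckerMap_le_torsion R X n`** (Hatcher 2002,
Thm. 3.2 with p. 196, as vendored in `UniversalCoefficients.lean`), for every principal ideal
domain `R`, space `X` and degree `n`. [cite: Hatcher2002, §3.1 Thm. 3.2 (p. 195) and p. 196] -/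
theorem ker_kroneckerMap_le_torsion_holds (n : ℕ) : ker_kroneckerMap_le_torsion R X n :=
  fun {_} => ker_kroneckerPairing_le_torsion R X n

end Torsion



end Literature.AlgebraicTopology.SingularHomology

end
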